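import Literature.Claims.NS.Zhong2026
import Literature.Analysis.FluidPDE.VorticityCalculus
import Summits.NavierStokesRegularity.NavierStokesRegularity.Theorems.SoloRefuteSantak2026
import HarnessLib

/-!
# C161 `Zhong2026` — ADDENDUM: the two «geometric constraints» are false at the print's pointwise grain

Refuter of record ns-claims-refuter-6 g3 (D-0090 NS-CLAIMS). Targets (skeleton rev 3, typist-9 g5):
`Literature.Claims.NS.Zhong2026.Step_geom_le_loc` (p.6 l.53–62 «|∇ω̂|² ≤ ⅓|∇ψ|²», consumed binder `hgl` of
`claim_of_printed_steps_loc`) and `Literature.Claims.NS.Zhong2026.Step_geom_ge_loc` (p.8 l.15–21 «|∇ω̂|² ≥ ⅓|∇ψ|²»,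
binder `hgg`). Class (cell vocabulary): false lemma (countermodel), kernel `not_Step_k : ¬ Step_k`, standard axioms.

Witness A (localised planar shear): `vₐ = curl (χ Aₐ)`, vorticity `(0, 0, 1 + y₀)` on the unit ball:
`|∇ω̂|²(0) = 0` while `∇ψ(0) = e₀ ≠ 0` — kills «|∇ω̂|² ≥ ⅓|∇ψ|²» (p.8 l.15–21).
Witness B: `v_b = curl (χ A_b)`, vorticity `(y₁, 0, 1)` on the unit ball: `∇ψ(0) = 0` (local minimum of
`|ω|`) while `|∇ω̂|²(0) ≥ 1` — kills «|∇ω̂|² ≤ ⅓|∇ψ|²» (p.6 l.53–62).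
Both are smooth, compactly supported, divergence free, all Sobolev norms finite (class `X`/`IsDatum`).

WHAT THIS IS NOT: not a claim about NS regularity or blow-up; not a claim about any author beyond the
typed locator.
-/

set_option linter.dupNamespace false

open Set Function MeasureTheory Filter Topology Metric
open scoped ContDiff Topology RealInnerProductSpace
open Literature.Analysis.FluidPDE Literature.Analysis.FluidPDE.Tao2016
open Literature.Claims.NS Literature.Claims.NS.Chae2007 Literature.Claims.NS.Zhong2026
open Literature.Claims.NS.Chishtie2025 (e)
open Summit.NavierStokesRegularity.NavierStokesRegularity.Theorems.Chishtie2025 (χ P P_apply)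

noncomputable section

namespace Summit.NavierStokesRegularity.NavierStokesRegularity.Theorems.Zhong2026

/-! ## Shared: localisation by the bump `χ` (≡ 1 on the unit ball) -/

/-- `χ A = A` near every point of the open unit ball. -/
theorem smul_eventuallyEq (A : E3 → E3) {y : E3} (hy : y ∈ ball (0 : E3) 1) :
    (fun x => χ x • A x) =ᶠ[𝓝 y] A := by
  filter_upwards [χ.eventuallyEq_one_of_mem_ball (by simpa [χ] using hy)] with x hx
  simp [hx]

/-- `curl (χ A) = curl A` on the unit ball. -/
theorem curl_smul_eq (A : E3 → E3) {y : E3} (hy : y ∈ ball (0 : E3) 1) :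
    curl (fun x => χ x • A x) y = curl A y := by
  rw [curl_eq_curlCLM, (smul_eventuallyEq A hy).fderiv_eq, ← curl_eq_curlCLM]

/-- A localised potential gives a class datum: `curl (χ A)` is smooth, compactly supported, divergence
free, with all `L²` Sobolev norms finite. -/
theorem isDatum_curl_smul {A : E3 → E3} (hA : ContDiff ℝ ∞ A) :
    IsDatum (curl fun x => χ x • A x) := by
  have hs : ContDiff ℝ ∞ fun x => χ x • A x := χ.contDiff.smul hA
  have hc : ContDiff ℝ ∞ (curl fun x => χ x • A x) :=
    contDiff_curl (n := (⊤ : ℕ∞)) (by exact_mod_cast hs)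
  have hk : HasCompactSupport (curl fun x => χ x • A x) :=
    hasCompactSupport_curl χ.hasCompactSupport.smul_right
  refine ⟨hc, fun x => ?_, fun n => Santak2026.lintegral_iteratedFDeriv_sq_lt_top hc hk n⟩
  show VectorCalculus.divergence (curl fun x => χ x • A x) x = 0
  exact divergence_curl_eq_zero_holds _ (hs.of_le (by norm_cast)) x

/-! ## Witness A: localised planar shear -/

/-- `Aₐ(y) = (0, 0, −(y₀²/2 + y₀³/6))`. -/
def ApotA (y : E3) : E3 := (-((1 / 2 : ℝ) * (y 0 * y 0) + (1 / 6 : ℝ) * (y 0 * y 0 * y 0))) • e 2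
/-- `Sₐ = curl Aₐ = (0, y₀ + y₀²/2, 0)`. -/
def shearA (y : E3) : E3 := (y 0 + (1 / 2 : ℝ) * (y 0 * y 0)) • e 1
/-- `Wₐ = curl Sₐ = (0, 0, 1 + y₀)`. -/
def vortA (y : E3) : E3 := (1 + y 0) • e 2
/-- The class datum `vₐ = curl (χ Aₐ)`. -/
def datumA : E3 → E3 := curl fun y => χ y • ApotA y

/-- The witness-A potential is smooth (a polynomial in `y 0` times a constant vector). -/
theorem contDiff_ApotA : ContDiff ℝ ∞ ApotA := by
  show ContDiff ℝ ∞ fun y =>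
    (-((1 / 2 : ℝ) * (P 0 y * P 0 y) + (1 / 6 : ℝ) * (P 0 y * P 0 y * P 0 y))) • e 2
  fun_prop

/-- Fréchet derivative of the witness-A potential. -/
theorem hasFDerivAt_ApotA (y : E3) :
    HasFDerivAt ApotA
      ((-((1 / 2 : ℝ) • (P 0 y • P 0 + P 0 y • P 0) +
          (1 / 6 : ℝ) • ((P 0 y * P 0 y) • P 0 + P 0 y • (P 0 y • P 0 + P 0 y • P 0)))).smulRight
        (e 2)) y := by
  show HasFDerivAt (fun y =>
    (-((1 / 2 : ℝ) * (P 0 y * P 0 y) + (1 / 6 : ℝ) * (P 0 y * P 0 y * P 0 y))) • e 2) _ y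
  exact ((((P 0).hasFDerivAt.mul (P 0).hasFDerivAt).const_mul (1 / 2 : ℝ)).add
    ((((P 0).hasFDerivAt.mul (P 0).hasFDerivAt).mul (P 0).hasFDerivAt).const_mul
      (1 / 6 : ℝ))).neg.smul_const (e 2)

/-- `curl ApotA = shearA` (planar shear profile `y₀ + y₀²/2` along `e 1`). -/
theorem curl_ApotA (y : E3) : curl ApotA y = shearA y := by
  ext i; fin_cases i <;> simp [curl, (hasFDerivAt_ApotA y).fderiv, shearA, e]
  ring

/-- Fréchet derivative of the witness-A shear field. -/
theorem hasFDerivAt_shearA (y : E3) :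
    HasFDerivAt shearA ((P 0 + (1 / 2 : ℝ) • (P 0 y • P 0 + P 0 y • P 0)).smulRight (e 1)) y := by
  show HasFDerivAt (fun y => (P 0 y + (1 / 2 : ℝ) * (P 0 y * P 0 y)) • e 1) _ y
  exact ((P 0).hasFDerivAt.add (((P 0).hasFDerivAt.mul (P 0).hasFDerivAt).const_mul
    (1 / 2 : ℝ))).smul_const (e 1)

/-- `curl shearA = vortA`: the vorticity of witness A is `(0, 0, 1 + y₀)`. -/
theorem curl_shearA (y : E3) : curl shearA y = vortA y := by
  ext i; fin_cases i <;> simp [curl, (hasFDerivAt_shearA y).fderiv, vortA, e]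
  ring

/-- On the unit ball the datum is the shear. -/
theorem datumA_eq {y : E3} (hy : y ∈ ball (0 : E3) 1) : datumA y = shearA y := by
  rw [datumA, curl_smul_eq ApotA hy, curl_ApotA]

/-- On the unit ball its vorticity is `Wₐ`. -/
theorem curl_datumA_eq {y : E3} (hy : y ∈ ball (0 : E3) 1) : curl datumA y = vortA y := by
  have h : datumA =ᶠ[𝓝 y] shearA := by
    filter_upwards [isOpen_ball.mem_nhds hy] with z hz using datumA_eq hz
  rw [curl_eq_curlCLM, h.fderiv_eq, ← curl_eq_curlCLM, curl_shearA]

/-- Near the origin the vorticity of `datumA` is `vortA` (the cut-off `χ` is `1` on the unit ball). -/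
theorem curl_datumA_eventuallyEq : curl datumA =ᶠ[𝓝 (0 : E3)] vortA := by
  filter_upwards [ball_mem_nhds (0 : E3) one_pos] with y hy using curl_datumA_eq hy

/-- `datumA` is a class datum (smooth, divergence-free as a curl, compactly supported hence `H^∞`). -/
theorem isDatum_datumA : IsDatum datumA := isDatum_curl_smul contDiff_ApotA

/-- At the origin the vorticity of witness A is `e 2`. -/
theorem curl_datumA_zero : curl datumA 0 = e 2 := by
  rw [curl_datumA_eventuallyEq.eq_of_nhds]; simp [vortA]

/-- The vorticity of witness A does not vanish at the origin (the `_loc` side condition). -/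
theorem curl_datumA_zero_ne : curl datumA 0 ≠ 0 := by
  rw [curl_datumA_zero]; intro h
  have := congrArg (fun v : E3 => v 2) h
  simp [e] at this

/-- Near the origin `y₀ > −1`. -/
theorem eventually_neg_one_lt : ∀ᶠ y in 𝓝 (0 : E3), (-1 : ℝ) < y 0 := by
  have h : ContinuousAt (fun y : E3 => P 0 y) 0 := (P 0).continuous.continuousAt
  have := continuousAt_const.eventually_lt h (by simp : (-1 : ℝ) < P 0 0)
  simpa using this

/-- `‖vortA y‖ = 1 + y₀` on the half-space `-1 < y₀`. -/
theorem norm_vortA {y : E3} (hy : (-1 : ℝ) < y 0) : ‖vortA y‖ = 1 + y 0 := by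
  rw [vortA, norm_smul, Real.norm_eq_abs, abs_of_pos (by linarith)]
  simp [e]

/-- The direction field of `ωₐ` is constant `e₂` near the origin. -/
theorem dirField_curl_datumA : dirField (curl datumA) =ᶠ[𝓝 (0 : E3)] fun _ => e 2 := by
  filter_upwards [curl_datumA_eventuallyEq, eventually_neg_one_lt] with y hy hy1
  rw [dirField, hy, norm_vortA hy1, vortA, smul_smul, inv_mul_cancel₀ (by linarith), one_smul]

/-- Hence `|∇ω̂ₐ|²(0) = 0`. -/
theorem gradDirSq_datumA : gradDirSq (curl datumA) 0 = 0 := by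
  rw [gradDirSq, dirField_curl_datumA.fderiv_eq]
  simp

/-- `ψₐ = log (1 + y₀)` near the origin. -/
theorem psi_curl_datumA : psi (curl datumA) =ᶠ[𝓝 (0 : E3)] fun y => Real.log (1 + P 0 y) := by
  filter_upwards [curl_datumA_eventuallyEq, eventually_neg_one_lt] with y hy hy1
  rw [psi, hy, norm_vortA hy1, P_apply]

/-- `∇ψ(0) = e 0` for witness A (`ψ = log |ω| = log (1 + y₀)` near `0`), as the functional `P 0`. -/
theorem fderiv_psi_datumA : fderiv ℝ (psi (curl datumA)) 0 = P 0 := by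
  rw [psi_curl_datumA.fderiv_eq]
  have h : HasFDerivAt (fun y : E3 => Real.log (1 + P 0 y)) ((1 + P 0 0)⁻¹ • P 0) 0 :=
    ((P 0).hasFDerivAt.const_add 1).log (by simp)
  rw [h.fderiv]; simp

/-- Hence `∇ψₐ(0) = e₀ ≠ 0`. -/
theorem gpsi_datumA_ne : gpsi (curl datumA) 0 ≠ 0 := by
  intro h
  have h1 : (InnerProductSpace.toDual ℝ E3).symm (fderiv ℝ (psi (curl datumA)) 0) = 0 := h
  rw [fderiv_psi_datumA] at h1
  have h2 : (P 0 : E3 →L[ℝ] ℝ) = 0 := by simpa using h1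
  have := congrArg (fun L : E3 →L[ℝ] ℝ => L (e 0)) h2
  simp [e] at this

/-- **Witness A refutes «|∇ω̂|² ≥ ⅓|∇ψ|²» at a point of non-zero vorticity of a class field.** -/
theorem not_geom_ge_at_datumA :
    ¬ (1 / 3 * ‖gpsi (curl datumA) 0‖ ^ 2 ≤ gradDirSq (curl datumA) 0) := by
  rw [gradDirSq_datumA]; intro h
  have : ‖gpsi (curl datumA) 0‖ = 0 := by nlinarith [norm_nonneg (gpsi (curl datumA) 0)]
  exact gpsi_datumA_ne (norm_eq_zero.mp this)

/-! ## Witness B: vorticity `(y₁, 0, 1)` — direction turns at a critical point of `|ω|` -/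

/-- `A_b(y) = (−y₁³/6, 0, −(y₀² + y₁²)/4)`. -/
def ApotB (y : E3) : E3 :=
  (-((1 / 6 : ℝ) * (y 1 * y 1 * y 1))) • e 0 + (-((1 / 4 : ℝ) * (y 0 * y 0 + y 1 * y 1))) • e 2
/-- `S_b = curl A_b = (−y₁/2, y₀/2, y₁²/2)`. -/
def shearB (y : E3) : E3 :=
  (-((1 / 2 : ℝ) * y 1)) • e 0 + ((1 / 2 : ℝ) * y 0) • e 1 + ((1 / 2 : ℝ) * (y 1 * y 1)) • e 2
/-- `W_b = curl S_b = (y₁, 0, 1)`. -/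
def vortB (y : E3) : E3 := (y 1) • e 0 + e 2
/-- The class datum `v_b = curl (χ A_b)`. -/
def datumB : E3 → E3 := curl fun y => χ y • ApotB y

/-- The witness-B potential is smooth (polynomial components). -/
theorem contDiff_ApotB : ContDiff ℝ ∞ ApotB := by
  show ContDiff ℝ ∞ fun y => (-((1 / 6 : ℝ) * (P 1 y * P 1 y * P 1 y))) • e 0 +
    (-((1 / 4 : ℝ) * (P 0 y * P 0 y + P 1 y * P 1 y))) • e 2
  fun_prop

/-- Fréchet derivative of the witness-B potential. -/
theorem hasFDerivAt_ApotB (y : E3) :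
    HasFDerivAt ApotB
      ((-((1 / 6 : ℝ) • ((P 1 y * P 1 y) • P 1 + P 1 y • (P 1 y • P 1 + P 1 y • P 1)))).smulRight
          (e 0) +
        (-((1 / 4 : ℝ) • ((P 0 y • P 0 + P 0 y • P 0) + (P 1 y • P 1 + P 1 y • P 1)))).smulRight
          (e 2)) y := by
  show HasFDerivAt (fun y => (-((1 / 6 : ℝ) * (P 1 y * P 1 y * P 1 y))) • e 0 +
    (-((1 / 4 : ℝ) * (P 0 y * P 0 y + P 1 y * P 1 y))) • e 2) _ y
  exact (((((P 1).hasFDerivAt.mul (P 1).hasFDerivAt).mul (P 1).hasFDerivAt).const_mul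
    (1 / 6 : ℝ)).neg.smul_const (e 0)).add
    (((((P 0).hasFDerivAt.mul (P 0).hasFDerivAt).add ((P 1).hasFDerivAt.mul
      (P 1).hasFDerivAt)).const_mul (1 / 4 : ℝ)).neg.smul_const (e 2))

/-- `curl ApotB = shearB`. -/
theorem curl_ApotB (y : E3) : curl ApotB y = shearB y := by
  ext i; fin_cases i <;> simp [curl, (hasFDerivAt_ApotB y).fderiv, shearB, e] <;> ring

/-- Fréchet derivative of the witness-B shear field. -/
theorem hasFDerivAt_shearB (y : E3) :
    HasFDerivAt shearB
      ((-((1 / 2 : ℝ) • P 1)).smulRight (e 0) + ((1 / 2 : ℝ) • P 0).smulRight (e 1) +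
        ((1 / 2 : ℝ) • (P 1 y • P 1 + P 1 y • P 1)).smulRight (e 2)) y := by
  show HasFDerivAt (fun y => (-((1 / 2 : ℝ) * P 1 y)) • e 0 + ((1 / 2 : ℝ) * P 0 y) • e 1 +
    ((1 / 2 : ℝ) * (P 1 y * P 1 y)) • e 2) _ y
  exact ((((P 1).hasFDerivAt.const_mul (1 / 2 : ℝ)).neg.smul_const (e 0)).add
    (((P 0).hasFDerivAt.const_mul (1 / 2 : ℝ)).smul_const (e 1))).add
    ((((P 1).hasFDerivAt.mul (P 1).hasFDerivAt).const_mul (1 / 2 : ℝ)).smul_const (e 2))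

/-- `curl shearB = vortB`: the vorticity of witness B is `(y₁, 0, 1)`. -/
theorem curl_shearB (y : E3) : curl shearB y = vortB y := by
  ext i; fin_cases i <;> simp [curl, (hasFDerivAt_shearB y).fderiv, vortB, e] <;> ring

/-- On the unit ball `datumB = shearB` (the cut-off `χ` is `1` there). -/
theorem datumB_eq {y : E3} (hy : y ∈ ball (0 : E3) 1) : datumB y = shearB y := by
  rw [datumB, curl_smul_eq ApotB hy, curl_ApotB]

/-- On the unit ball the vorticity of `datumB` is `vortB`. -/
theorem curl_datumB_eq {y : E3} (hy : y ∈ ball (0 : E3) 1) : curl datumB y = vortB y := by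
  have h : datumB =ᶠ[𝓝 y] shearB := by
    filter_upwards [isOpen_ball.mem_nhds hy] with z hz using datumB_eq hz
  rw [curl_eq_curlCLM, h.fderiv_eq, ← curl_eq_curlCLM, curl_shearB]

/-- Near the origin the vorticity of `datumB` is `vortB`. -/
theorem curl_datumB_eventuallyEq : curl datumB =ᶠ[𝓝 (0 : E3)] vortB := by
  filter_upwards [ball_mem_nhds (0 : E3) one_pos] with y hy using curl_datumB_eq hy

/-- `datumB` is a class datum (smooth, divergence-free as a curl, compactly supported hence `H^∞`). -/
theorem isDatum_datumB : IsDatum datumB := isDatum_curl_smul contDiff_ApotB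

/-- At the origin the vorticity of witness B is `e 2`. -/
theorem curl_datumB_zero : curl datumB 0 = e 2 := by
  rw [curl_datumB_eventuallyEq.eq_of_nhds]; simp [vortB]

/-- The vorticity of witness B does not vanish at the origin (the `_loc` side condition). -/
theorem curl_datumB_zero_ne : curl datumB 0 ≠ 0 := by
  rw [curl_datumB_zero]; intro h
  have := congrArg (fun v : E3 => v 2) h
  simp [e] at this

/-- `‖W_b(y)‖ ≥ 1 = ‖W_b(0)‖`. -/
theorem one_le_norm_vortB (y : E3) : 1 ≤ ‖vortB y‖ := by
  have h := real_inner_le_norm (vortB y) (e 2)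
  have hi : ⟪vortB y, e 2⟫ = 1 := by
    simp [vortB, e, EuclideanSpace.inner_single_right]
  have hn : ‖e 2‖ = 1 := by simp [e]
  rw [hi, hn, mul_one] at h
  exact h

/-- `ψ_b` has a local minimum at the origin, so `∇ψ_b(0) = 0`. -/
theorem gpsi_datumB : gpsi (curl datumB) 0 = 0 := by
  have hmin : IsLocalMin (psi (curl datumB)) 0 := by
    filter_upwards [curl_datumB_eventuallyEq] with y hy
    rw [psi, psi, hy, curl_datumB_zero]
    have h0 : ‖e 2‖ = 1 := by simp [e]
    rw [h0, Real.log_one]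
    exact Real.log_nonneg (one_le_norm_vortB y)
  have h := hmin.fderiv_eq_zero
  show (InnerProductSpace.toDual ℝ E3).symm (fderiv ℝ (psi (curl datumB)) 0) = 0
  rw [h]; simp

/-- `‖vortB y‖ = √(1 + y₁²)`. -/
theorem norm_vortB (y : E3) : ‖vortB y‖ = Real.sqrt (1 + P 1 y * P 1 y) := by
  rw [EuclideanSpace.norm_eq]
  congr 1
  simp [vortB, e, Fin.sum_univ_three]
  ring

/-- The explicit direction field near the origin. -/
def dirB (y : E3) : E3 := (Real.sqrt (1 + P 1 y * P 1 y))⁻¹ • vortB y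

/-- Near the origin the vorticity direction of witness B is `dirB = (1 + y₁²)^{-1/2} • vortB`. -/
theorem dirField_curl_datumB : dirField (curl datumB) =ᶠ[𝓝 (0 : E3)] dirB := by
  filter_upwards [curl_datumB_eventuallyEq] with y hy
  rw [dirField, hy, norm_vortB, dirB]

/-- Fréchet derivative of `vortB`: `y ↦ (P 1 y) • e 0`. -/
theorem hasFDerivAt_vortB (y : E3) : HasFDerivAt vortB ((P 1).smulRight (e 0)) y := by
  show HasFDerivAt (fun y => (P 1 y) • e 0 + e 2) _ y
  exact ((P 1).hasFDerivAt.smul_const (e 0)).add_const (e 2)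

/-- `|∇ω̂_b|²(0) ≥ 1`: the derivative of the direction field at `0` sends `e₁ ↦ e₀`. -/
theorem one_le_gradDirSq_datumB : 1 ≤ gradDirSq (curl datumB) 0 := by
  have h1 : HasFDerivAt (fun y : E3 => 1 + P 1 y * P 1 y) (P 1 (0 : E3) • P 1 + P 1 (0 : E3) • P 1)
      0 := ((P 1).hasFDerivAt.mul (P 1).hasFDerivAt).const_add 1
  have h2 : HasFDerivAt (fun y : E3 => Real.sqrt (1 + P 1 y * P 1 y)) _ 0 := h1.sqrt (by simp)
  have h3 := (hasDerivAt_inv (x := Real.sqrt (1 + P 1 (0 : E3) * P 1 (0 : E3)))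
    (by simp)).comp_hasFDerivAt (0 : E3) h2
  have hD : HasFDerivAt dirB _ 0 := h3.smul (hasFDerivAt_vortB 0)
  rw [gradDirSq, dirField_curl_datumB.fderiv_eq, hD.fderiv,
    frobeniusNormSq_eq_sum (EuclideanSpace.basisFun (Fin 3) ℝ), Fin.sum_univ_three]
  simp [e, vortB]

/-- **Witness B refutes «|∇ω̂|² ≤ ⅓|∇ψ|²» at a point of non-zero vorticity of a class field.** -/
theorem not_geom_le_at_datumB :
    ¬ (gradDirSq (curl datumB) 0 ≤ 1 / 3 * ‖gpsi (curl datumB) 0‖ ^ 2) := by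
  rw [gpsi_datumB]; intro h
  have := one_le_gradDirSq_datumB
  simp at h
  linarith


/-! ## The refutations (tree rev 3 faces) -/

/-- **Refutes `Literature.Claims.NS.Zhong2026.Step_geom_le_loc`** (p.6 l.53–62 «the geometric constraint of
vortex filaments provides |∇ω̂|² ≤ ⅓|∇ψ|²», pointwise where ω(x) ≠ 0): witness B, a smooth compactly supported
divergence-free field whose vorticity is `(y₁, 0, 1)` on the unit ball — at the origin `∇ψ = 0` and
`|∇ω̂|² ≥ 1`. Class: false lemma (countermodel). -/
theorem not_Step_geom_le_loc : ¬ Literature.Claims.NS.Zhong2026.Step_geom_le_loc :=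
  fun h => not_geom_le_at_datumB (h datumB isDatum_datumB 0 curl_datumB_zero_ne)

/-- **Refutes `Literature.Claims.NS.Zhong2026.Step_geom_ge_loc`** (proof of Lemma 6.1, p.8 l.15–21 «the
geometric constraint |∇ω̂|² ≥ ⅓|∇ψ|²», pointwise where ω(x) ≠ 0): witness A, the localised planar shear with
vorticity `(0, 0, 1 + y₀)` on the unit ball — at the origin `|∇ω̂|² = 0` and `∇ψ = e₀ ≠ 0`.
Class: false lemma (countermodel). -/
theorem not_Step_geom_ge_loc : ¬ Literature.Claims.NS.Zhong2026.Step_geom_ge_loc :=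
  fun h => not_geom_ge_at_datumA (h datumA isDatum_datumA 0 curl_datumA_zero_ne)

/-- The two printed constraints are jointly impossible wherever exactly one side vanishes: at `datumA`'s
origin «≤ ⅓» holds strictly and «≥ ⅓» fails. (Records.) -/
theorem gradDirSq_lt_at_datumA : gradDirSq (curl datumA) 0 < 1 / 3 * ‖gpsi (curl datumA) 0‖ ^ 2 := by
  rw [gradDirSq_datumA]
  have h := gpsi_datumA_ne
  positivity

/-! ## FQN guards -/
example : ¬ Literature.Claims.NS.Zhong2026.Step_geom_le_loc := not_Step_geom_le_loc
example : ¬ Literature.Claims.NS.Zhong2026.Step_geom_ge_loc := not_Step_geom_ge_loc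

end Summit.NavierStokesRegularity.NavierStokesRegularity.Theorems.Zhong2026

end
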